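import Summits.BirchSwinnertonDyer.BirchSwinnertonDyer.Theses.KatoDescentPotSupersingular
import Summits.BirchSwinnertonDyer.Rank1Residual.O6.KatoHullRankOneDescent
import Summits.BirchSwinnertonDyer.Rank1Residual.O6.PotGoodOfHullKMC
import HarnessLib

/-!
# Route `KatoDescentPotSupersingular` (rung K9, cell `bsd-potss`): the declared residual `WildRankOne`
# (item stmt-BirchSwinnertonDyer-19200) FROM KMC₃ ∧ PR^× IN HULL CURRENCY — at ANY member, rational
# `3`-torsion allowed; no torsion-free member, no Mazur–Kenku walk (a `--supports … --as helper` file)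

Route.md, two-layer plan: "WildRankOne ⇐ (KMC₃) → (Perrin-Riou up to unit, `Additive.PerrinRiouUpToUnitAt`)
→ (kernel descent …)". The sibling helper `KatoDescentPotSupersingularWildRankOneOfKMC.lean` (seat kmc
part 10/14, p417957) ran the descent at the `3`-TORSION-FREE member of the class (readings
`TorsionFree.*`, named fact `mazurKenku_exists_cyclic_isogeny`), because Burns–Kurihara–Sano's rank-one
count (Thm. 7.3) carries the standing hypothesis "`H¹(ℤ_S,T)` is `ℤ_p`-free", i.e. `E(ℚ)[p] = 0`. Part
15 of the descent files (`O6/KatoHullRankOneExactCount.lean`, `O6/KatoHullRankOneDescent.lean`,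
`O6/PotGoodRankOneOfHullKMC.lean`) removes that hypothesis: the EXACT rank-one count at an arbitrary
member, `v_p ℒ = m + ord_p #Ш + v_p Tam − 2t` (Reading M3♯-r1), gives `KMC ∧ PR^× ⟹ BSD_p` at every
hull-realised member, so the glue needs only Reading M1♯ (`KatoHull.Realizable`: a hull datum at SOME
member of each class — Kato's member), Reading M3♯-r1, the interface lemma `KatoHull.ReadsKMC`, and
Cassels / GZK / modularity. This file restates it with the ROUTE DECL as its type. CONDITIONAL (audit
`proof.conditional`); the item is NOT closed. Seat `bsd-potss-kmc` generation 8.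

References: [Kato2004Asterisque] Conj. 12.10 (p. 224), §14.14 (p. 243); [BurnsKuriharaSano2019] Conj.
1.5 (p. 5), Hyp. 2.2 (p. 9), Thm. 7.3 / 7.6 (p. 29); [Cassels1965ArithmeticVIII]; [Miller2011LMS] Def. 1.1.
-/

set_option autoImplicit false
-- sibling precedent (`KatoDescentPotSupersingularAssembly.lean`): the directory name repeats the summit name
set_option linter.dupNamespace false

noncomputable section

open scoped Classical

namespace Summit.BirchSwinnertonDyer.BirchSwinnertonDyer.Theorems

open WeierstrassCurve Literature.NumberTheory.EllipticCurves
  Literature.NumberTheory.EllipticCurves.Rank1Residual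
  Literature.NumberTheory.EllipticCurves.Rank1Residual.Typed
  Summit.BirchSwinnertonDyer.Rank1Residual.Additive
  Summit.BirchSwinnertonDyer.Rank1Residual
  Summit.BirchSwinnertonDyer.BirchSwinnertonDyer.Theses.KatoDescentPotSupersingular

variable {IsHullOf : ∀ (W : WeierstrassCurve ℚ) [W.IsElliptic] [W.IsGloballyMinimal] (p : ℕ)
  [Fact p.Prime], KatoHullDescentDatum p → Prop}
variable {PRRatio : ∀ (W : WeierstrassCurve ℚ) [W.IsElliptic] [W.IsGloballyMinimal] (p : ℕ)
  [Fact p.Prime], ℚ_[p] → Prop}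
variable {KMC : ∀ (W : WeierstrassCurve ℚ) [W.IsElliptic] [W.IsGloballyMinimal] (p : ℕ), Prop}

/-- **Rank-one DescentGlue for the K9 residual `WildRankOne`, hull currency**: KMC₃ ∧ PR^× at the
members of each wild analytic-rank-one class (hypothesis `hKP`, stated on the class), over Readings M1♯ /
M3♯-r1, the interface lemma `ReadsKMC`, and Cassels / GZK / modularity ⟹ `WildRankOne` (type = the
route decl verbatim), from `KatoHull.rankOne_bsdp_of_kmc_of_perrinRiou` at the realised member + Cassels. ANY rational `3`-torsion at the
realised member (Burns–Kurihara–Sano's Hyp. 2.2 (i) removed); no Mazur–Kenku. Conditional over displayed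
hypotheses; nothing about Kato's objects or Perrin-Riou's conjecture is asserted; the item is not closed.
[cite: Kato2004Asterisque, Conj. 12.10 (p. 224), §14.14 (p. 243)] [cite: BurnsKuriharaSano2019, Conj. 1.5 (p. 5), Thm. 7.3 and Thm. 7.6 (p. 29)]
[cite: Cassels1965ArithmeticVIII] -/
theorem wildRankOne_of_hullKMC_of_perrinRiou (hRz : KatoHull.Realizable IsHullOf)
    (hC : KatoHull.RankOneExactCountReading IsHullOf PRRatio) (hK : KatoHull.ReadsKMC IsHullOf KMC)
    (hCassels : bsdRHS_eq_of_isIsogenous) (hGZK : rank_eq_analyticRank_of_analyticRank_le_one)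
    (hmod : hasEntireLFunction_rat)
    (hKP : ∀ (W W' : WeierstrassCurve ℚ) [W.IsElliptic] [W.IsGloballyMinimal] [W'.IsElliptic]
      [W'.IsGloballyMinimal],
      W.analyticRank = 1 → ClassO6 W 3 → IsIsogenous W W' → Addv W' 3 → 0 ≤ padicValRat 3 W'.j →
        KMC W' 3 ∧ PerrinRiouUpToUnitAt PRRatio W' 3) :
    Summit.BirchSwinnertonDyer.BirchSwinnertonDyer.Theses.KatoDescentPotSupersingular.WildRankOne := by
  intro W _ _ _ hr hO
  haveI : Finite W.sha := (hGZK W (by rw [hr])).2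
  refine missingPPartAt_of_bsdp W 3 ?_
  -- a hull datum at some member `W'` of the class (Reading M1♯), the hypotheses transported to it
  obtain ⟨W', hE', hM', hiso, D, hDof⟩ := hRz W 3 hO.1 hO.2.1 hO.padicValRat_j_nonneg
  obtain ⟨hadd', hj'⟩ :=
    Addv.of_isIsogenous_of_padicValRat_j_nonneg (p := 3) hO.2.1 hO.padicValRat_j_nonneg hiso
  have hr' : W'.analyticRank = 1 := by rw [← analyticRank_eq_of_isIsogenous' hiso, hr]
  obtain ⟨hkmc', hPR'⟩ := hKP W W' hr hO hiso hadd' hj'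
  -- KMC ∧ PR^× ⟹ BSD_p at the realised member (any torsion), then Cassels back to `W`
  have hbsd' : BSDp W' 3 :=
    KatoHull.rankOne_bsdp_of_kmc_of_perrinRiou hC hK hGZK hmod hO.1 hadd' hj' hr' hDof hkmc' hPR'
  exact N10.bsdp_of_isIsogenous_of_bsdp 3 hCassels hGZK hmod hiso (by rw [hr]) hbsd'

end Summit.BirchSwinnertonDyer.BirchSwinnertonDyer.Theorems

end
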